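import Literature.Computability.QuantumComplexity.PathModelPositionEncoding
import Literature.Computability.QuantumComplexity.JonesLoopCount
import HarnessLib

/-!
# The AJL crossing gate at `k = 5`: rank-one structure, the phase `e^{±3πi/5}`, and the phase-free core

Topic `Literature/Computability/QuantumComplexity`; a step in the discharge of
`ajl_jonesApproxProblem_mem_PromiseBQP` (`JonesInBQP.lean`). The local crossing gate
`ajlLocalCrossing ± = A^{±1} Φ_loc + A^{∓1} 1` of `JonesInBQPProofs.lean` (Aharonov–Jones–Landau 2009,
Def. 2.6 `ρ_A(σ_i) = A E_i + A⁻¹ I`, §2.12 path model, Claim 3.2) is analysed into the pieces a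
Clifford+`T` circuit will implement:

* **Rank-one structure** (`ajlLocalVec`, `ajlLocalPhi_eq_sum`): `Φ_loc = d Σ_{z=1}^{4} |φ_z⟩⟨φ_z|`
  with the four real vectors `φ_z = |z⟩ ⊗ (Σ_{b = z±1} √(λ_b/(dλ_z)) |b⟩) ⊗ |z⟩` on the three vertex
  registers (AJL Claim 2.6: `λ_{z−1} + λ_{z+1} = dλ_z`, so each `τ(E)`-block is `d` times a rank-one
  projection; for `z = 1, 4` the vector `φ_z` is a basis state, for `z = 2, 3` a golden-ratio
  superposition of two basis states of the middle register).
* **The phase** (`ajlPoint_five_sq_mul_d`, `ajlPhaseConst`): at `k = 5`, `A = e^{2πi/5}` and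
  `1 + A^{±2} d = e^{±3πi/5}`, so `ajlLocalCrossing ± = A^{∓1} · (1 + (e^{±3πi/5} − 1) P)` with
  `P = Σ_z |φ_z⟩⟨φ_z|` (`ajlLocalProj`, `ajlLocalCrossing_eq_smul_core`): up to the scalar `A^{∓1}`
  the gate is the **core** `ajlLocalCore ± = 1 + (e^{±3πi/5} − 1)P`, a unitary
  (`ajlLocalCore_mem_unitaryGroup`) which is the identity off `span{φ_z}` and the tenth root of unity
  `e^{±3πi/5}` on it.
* **Dropping the scalars is harmless for the algorithm** (`ajlPosCoreMatrix`,
  `ajlPosBraidMatrix_eq_smul_core`, `norm_ajlPosCoreMatrix_apply_encodePos`): the position-encoded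
  word built from the cores differs from `ajlPosBraidMatrix` by a unimodular scalar, so the modulus of
  its `⟨enc α| · |enc α⟩` entry is still `ajlRatio 5 n b` (with `ajl_thm32_matrixElement_holds` and
  `ajlPosBraidMatrix_apply_encodePos_ajlAlpha`); the promise problem `jonesApproxProblem` only reads
  this modulus.

So the quantum part of the algorithm needs, per crossing, a unitary `𝔉` with `𝔉 e_z = φ_z` (two
controlled real one-qubit rotations with `tan² = λ_3/λ_1 = φ` and `λ_1/λ_2 = 1/φ`) and the diagonal
phase `e^{±3πi/5}` on four basis states: `core = 𝔉 · diag · 𝔉†`. Their Clifford+`T` realisation is the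
subject of the sequel files.

## References

* D. Aharonov, V. Jones, Z. Landau, *A polynomial quantum algorithm for approximating the Jones
  polynomial*, Algorithmica 55 (2009) = arXiv:quant-ph/0511096, Def. 2.6, §2.12 (Claims 2.4–2.6),
  §2.13, Claim 3.2, Cor. 3.1, Thm. 3.2 [AharonovJonesLandau2009].
-/

noncomputable section

namespace Literature.Computability.QuantumComplexity

open Matrix Complex Finset

/-! ### The rank-one structure of `Φ_loc` -/

/-- The vertices of `G_5`. [cite: AharonovJonesLandau2009, §2.12] -/
def g5Vertices : Finset ℤ := {1, 2, 3, 4}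

/-- **The vector `φ_z`** (`z ∈ {1,…,4}`) on the three vertex registers: supported on the labels
reading `(z, b, z)` with `b = z ± 1`, with amplitude `√(λ_b) / √(d λ_z)`; a unit vector by Claim 2.6.
[cite: AharonovJonesLandau2009, Claim 2.6 and §2.12] -/
def ajlLocalVec (z : ℤ) (p : Cryptography.QReg 6) : ℝ :=
  if vertexOfBits (p 0) (p 1) = z ∧ vertexOfBits (p 4) (p 5) = z ∧
      (vertexOfBits (p 2) (p 3) = z + 1 ∨ vertexOfBits (p 2) (p 3) = z - 1) then
    Real.sqrt (ajlWeight 5 (vertexOfBits (p 2) (p 3))) / Real.sqrt (ajlLoopValue 5 * ajlWeight 5 z)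
  else 0

/-- `d λ_z > 0` for a vertex `z` of `G_5`. [cite: AharonovJonesLandau2009, Claim 2.6] -/
theorem ajlLoopValue_mul_ajlWeight_pos {z : ℤ} (hz : 1 ≤ z ∧ z ≤ 4) : 0 < ajlLoopValue 5 * ajlWeight 5 z :=
  mul_pos (ajlLoopValue_pos (by norm_num)) (ajlWeight_pos (k := 5) (by omega))

/-- **`Φ_loc = d Σ_z |φ_z⟩⟨φ_z|`**: the local path-model generator is `d` times the orthogonal
projection onto the span of the four vectors `φ_z`. [cite: AharonovJonesLandau2009, Claims 2.4–2.6 and §2.12] -/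
theorem ajlLocalPhi_eq_sum (q p : Cryptography.QReg 6) :
    ajlLocalPhi q p = ajlLoopValue 5 * ∑ z ∈ g5Vertices, ajlLocalVec z q * ajlLocalVec z p := by
  rw [ajlLocalPhi_apply]
  by_cases h : LocalSupport q p
  · rw [if_pos h]
    obtain ⟨h1, h2, h3, h4, h5⟩ := h
    set z := vertexOfBits (p 0) (p 1) with hz
    have hzmem : 1 ≤ z ∧ z ≤ 4 := vertexOfBits_mem _ _
    have hzin : z ∈ g5Vertices := by
      simp only [g5Vertices, Finset.mem_insert, Finset.mem_singleton]; omega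
    rw [← Finset.add_sum_erase _ _ hzin, Finset.sum_eq_zero, add_zero]
    · -- the `z`-term
      have hq : ajlLocalVec z q = Real.sqrt (ajlWeight 5 (vertexOfBits (q 2) (q 3))) / Real.sqrt (ajlLoopValue 5 * ajlWeight 5 z) := by
        rw [ajlLocalVec, if_pos ⟨h1.symm, by rw [← h2, ← h3], h5⟩]
      have hp : ajlLocalVec z p = Real.sqrt (ajlWeight 5 (vertexOfBits (p 2) (p 3))) / Real.sqrt (ajlLoopValue 5 * ajlWeight 5 z) := by
        rw [ajlLocalVec, if_pos ⟨rfl, h3.symm, h4⟩]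
      rw [hq, hp]
      have hpos := ajlLoopValue_mul_ajlWeight_pos hzmem
      have hd := ajlLoopValue_pos (show 3 ≤ 5 by norm_num)
      have hw := ajlWeight_pos (k := 5) (ℓ := z) (by omega)
      rw [div_mul_div_comm, ← Real.sqrt_mul (ajlWeight_nonneg _ _), Real.mul_self_sqrt hpos.le, mul_comm (ajlWeight 5 _)]
      field_simp
    · intro z' hz'
      rw [Finset.mem_erase] at hz'
      rw [ajlLocalVec, ajlLocalVec]
      split_ifs with hq' hp'
      · exact absurd hp'.1 (fun e => hz'.1 (by rw [← e]))
      · exact mul_zero _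
      · exact zero_mul _
      · exact mul_zero _
  · rw [if_neg h]
    symm
    rw [mul_eq_zero]
    right
    refine Finset.sum_eq_zero fun z _ => ?_
    rw [ajlLocalVec, ajlLocalVec]
    split_ifs with hq hp
    · exact absurd ⟨hp.1.trans hq.1.symm, hp.2.1.trans hq.2.1.symm, hp.1.trans hp.2.1.symm,
        by rw [hp.1]; exact hp.2.2, by rw [hp.1]; exact hq.2.2⟩ h
    · exact mul_zero _
    · exact zero_mul _
    · exact mul_zero _

/-- **The projection `P = Σ_z |φ_z⟩⟨φ_z|`** onto the span of the `φ_z`, as a complex matrix.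
[cite: AharonovJonesLandau2009, §2.12] -/
def ajlLocalProj : Matrix (Cryptography.QReg 6) (Cryptography.QReg 6) ℂ :=
  Matrix.of fun q p => ((∑ z ∈ g5Vertices, ajlLocalVec z q * ajlLocalVec z p : ℝ) : ℂ)

/-- `Φ_loc = d P` over `ℂ`. [cite: AharonovJonesLandau2009, Claims 2.4–2.6] -/
theorem ajlLocalPhi_map_eq_smul_proj : ajlLocalPhi.map ((↑) : ℝ → ℂ) = (ajlLoopValue 5 : ℂ) • ajlLocalProj := by
  ext q p
  rw [Matrix.map_apply, ajlLocalPhi_eq_sum, Matrix.smul_apply, ajlLocalProj, Matrix.of_apply, smul_eq_mul, Complex.ofReal_mul]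

/-! ### The phase: `A = e^{2πi/5}`, `1 + A^{±2} d = e^{±3πi/5}` -/

/-- `d = 2cos(π/5)` as a sum of exponentials. [cite: AharonovJonesLandau2009, §2.13] -/
theorem ajlLoopValue_five_eq_exp :
    (ajlLoopValue 5 : ℂ) = Complex.exp ((Real.pi / 5 : ℝ) * I) + Complex.exp (-(Real.pi / 5 : ℝ) * I) := by
  rw [ajlLoopValue, Complex.ofReal_mul, Complex.ofReal_cos, Complex.ofReal_ofNat, Complex.two_cos]
  push_cast
  ring_nf

/-- **`1 + A² d = e^{3πi/5}`** at `k = 5` (`A² = −e^{−iπ/5}`). [cite: AharonovJonesLandau2009, §2.13 (d = −A² − A⁻²)] -/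
theorem ajlPoint_five_sq_mul_d :
    1 + ajlPoint 5 ^ 2 * (ajlLoopValue 5 : ℂ) = Complex.exp ((3 * Real.pi / 5 : ℝ) * I) := by
  rw [ajlPoint_sq, ajlLoopValue_five_eq_exp]
  have e3 : ((3 * Real.pi / 5 : ℝ) : ℂ) * I = (Real.pi : ℂ) * I + (-(Real.pi / 5 : ℝ) * I + -(Real.pi / 5 : ℝ) * I) := by
    push_cast; ring
  rw [e3, Complex.exp_add, Complex.exp_pi_mul_I, Complex.exp_add]
  have e0 : Complex.exp (-(Real.pi / 5 : ℝ) * I) * Complex.exp ((Real.pi / 5 : ℝ) * I) = 1 := by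
    rw [← Complex.exp_add]; push_cast; ring_nf; exact Complex.exp_zero
  have : (-Complex.exp (-(↑(Real.pi / (5 : ℕ)) : ℂ) * I)) = -Complex.exp (-(Real.pi / 5 : ℝ) * I) := by norm_num
  rw [this]
  linear_combination (-1 : ℂ) * e0

/-- **`1 + A⁻² d = e^{−3πi/5}`** at `k = 5`. [cite: AharonovJonesLandau2009, §2.13] -/
theorem ajlPoint_five_inv_sq_mul_d :
    1 + (ajlPoint 5)⁻¹ ^ 2 * (ajlLoopValue 5 : ℂ) = Complex.exp (-(3 * Real.pi / 5 : ℝ) * I) := by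
  have hinv : (ajlPoint 5)⁻¹ ^ 2 = -Complex.exp ((Real.pi / 5 : ℝ) * I) := by
    rw [ajlPoint_inv, ← map_pow, ajlPoint_sq, map_neg, ← Complex.exp_conj, map_mul, Complex.conj_I, map_neg, Complex.conj_ofReal]
    norm_num
  rw [hinv, ajlLoopValue_five_eq_exp]
  have e3 : (-(3 * Real.pi / 5 : ℝ) : ℂ) * I = (-(2 * Real.pi) : ℂ) * I + ((Real.pi : ℂ) * I + ((Real.pi / 5 : ℝ) * I + (Real.pi / 5 : ℝ) * I)) := by
    push_cast; ring
  have hper : Complex.exp ((-(2 * Real.pi) : ℂ) * I) = 1 := by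
    rw [show (-(2 * Real.pi) : ℂ) * I = -(2 * Real.pi * I) by ring, Complex.exp_neg, Complex.exp_two_pi_mul_I, inv_one]
  rw [e3, Complex.exp_add, hper, one_mul, Complex.exp_add, Complex.exp_pi_mul_I, Complex.exp_add]
  have e0 : Complex.exp ((Real.pi / 5 : ℝ) * I) * Complex.exp (-(Real.pi / 5 : ℝ) * I) = 1 := by
    rw [← Complex.exp_add]; push_cast; ring_nf; exact Complex.exp_zero
  linear_combination (-1 : ℂ) * e0

/-- **The AJL phase** `c_± = e^{±3πi/5}`, the eigenvalue of the crossing core on `span{φ_z}`.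
[cite: AharonovJonesLandau2009, Def. 2.6 and §2.13] -/
def ajlPhaseConst (positive : Bool) : ℂ :=
  if positive then Complex.exp ((3 * Real.pi / 5 : ℝ) * I) else Complex.exp (-(3 * Real.pi / 5 : ℝ) * I)

/-- `|c_±| = 1`. [folklore] -/
theorem norm_ajlPhaseConst (positive : Bool) : ‖ajlPhaseConst positive‖ = 1 := by
  cases positive
  · show ‖Complex.exp (-(3 * Real.pi / 5 : ℝ) * I)‖ = 1
    rw [← Complex.ofReal_neg]
    exact Complex.norm_exp_ofReal_mul_I _
  · exact Complex.norm_exp_ofReal_mul_I _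

/-- `c_± − 1 = A^{±2} d`. [cite: AharonovJonesLandau2009, §2.13] -/
theorem ajlPhaseConst_sub_one (positive : Bool) :
    ajlPhaseConst positive - 1 = crossingWeight (ajlPoint 5) positive true ^ 2 * (ajlLoopValue 5 : ℂ) := by
  cases positive
  · simp only [ajlPhaseConst, Bool.false_eq_true, if_false, crossingWeight_false, if_true]
    rw [← ajlPoint_five_inv_sq_mul_d]; ring
  · simp only [ajlPhaseConst, if_true, crossingWeight_true]
    rw [← ajlPoint_five_sq_mul_d]; ring

/-! ### The phase-free core of the crossing gate -/

/-- **The core of the crossing gate**: `1 + (c_± − 1) P`, identity off `span{φ_z}` and the phase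
`c_± = e^{±3πi/5}` on it. [cite: AharonovJonesLandau2009, Def. 2.6 and Claim 3.2] -/
def ajlLocalCore (positive : Bool) : Matrix (Cryptography.QReg 6) (Cryptography.QReg 6) ℂ :=
  1 + (ajlPhaseConst positive - 1) • ajlLocalProj

/-- The weights `A^{±1}` are inverse to each other. [folklore] -/
theorem crossingWeight_true_mul_false (positive : Bool) :
    crossingWeight (ajlPoint 5) positive true * crossingWeight (ajlPoint 5) positive false = 1 := by
  have h := ajlPoint_ne_zero 5
  cases positive <;> simp [h]

/-- **`ajlLocalCrossing ± = A^{∓1} · core`**: the crossing gate is its identity weight times the core.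
[cite: AharonovJonesLandau2009, Def. 2.6 and Claim 3.2] -/
theorem ajlLocalCrossing_eq_smul_core (positive : Bool) :
    ajlLocalCrossing positive = crossingWeight (ajlPoint 5) positive false • ajlLocalCore positive := by
  rw [ajlLocalCrossing, ajlLocalPhi_map_eq_smul_proj, ajlLocalCore, ajlPhaseConst_sub_one, smul_add, smul_smul, smul_smul]
  have h1 := crossingWeight_true_mul_false positive
  have e : crossingWeight (ajlPoint 5) positive false * (crossingWeight (ajlPoint 5) positive true ^ 2 * (ajlLoopValue 5 : ℂ)) =
      crossingWeight (ajlPoint 5) positive true * (ajlLoopValue 5 : ℂ) := by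
    linear_combination (crossingWeight (ajlPoint 5) positive true * (ajlLoopValue 5 : ℂ)) * h1
  rw [e, add_comm]

/-- The identity weight is a unit complex number. [folklore] -/
theorem norm_crossingWeight_ajlPoint (positive smooth : Bool) : ‖crossingWeight (ajlPoint 5) positive smooth‖ = 1 := by
  cases positive <;> cases smooth <;> simp [norm_ajlPoint]

/-- **The core is unitary** (a unimodular multiple of the unitary crossing gate). [cite: AharonovJonesLandau2009, Claim 2.2] -/
theorem ajlLocalCore_mem_unitaryGroup (positive : Bool) :
    ajlLocalCore positive ∈ Matrix.unitaryGroup (Cryptography.QReg 6) ℂ := by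
  have hw0 : crossingWeight (ajlPoint 5) positive false ≠ 0 := by
    intro h; have := norm_crossingWeight_ajlPoint positive false; rw [h, norm_zero] at this; exact zero_ne_one this
  have hcore : ajlLocalCore positive = (crossingWeight (ajlPoint 5) positive false)⁻¹ • ajlLocalCrossing positive := by
    rw [ajlLocalCrossing_eq_smul_core, smul_smul, inv_mul_cancel₀ hw0, one_smul]
  rw [hcore]
  refine Unitary.smul_mem_of_mem ?_ (ajlLocalCrossing_mem_unitaryGroup positive)
  have hu : ‖(crossingWeight (ajlPoint 5) positive false)⁻¹‖ = 1 := by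
    rw [norm_inv, norm_crossingWeight_ajlPoint, inv_one]
  rw [Unitary.mem_iff, Complex.star_def, Complex.conj_mul', Complex.mul_conj', hu]
  simp

/-! ### The position-encoded word built from the cores -/

variable {n : ℕ}

/-- The position-encoded word with every crossing gate replaced by its core (the unitary the
quantum circuit implements, letter by letter). [cite: AharonovJonesLandau2009, Cor. 3.1] -/
def ajlPosCoreMatrix (b : BraidWord n) : Matrix (Cryptography.QReg (2 * (n + 1))) (Cryptography.QReg (2 * (n + 1))) ℂ :=
  (b.map fun g => Cryptography.placeGate (tripleEmb g.1) (ajlLocalCore g.2)).prod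

/-- The product of the identity weights of the letters of a word (a unimodular scalar). [folklore] -/
def ajlWordPhase (b : BraidWord n) : ℂ := (b.map fun g => crossingWeight (ajlPoint 5) g.2 false).prod

/-- The word phase is unimodular. [folklore] -/
theorem norm_ajlWordPhase (b : BraidWord n) : ‖ajlWordPhase b‖ = 1 := by
  induction b with
  | nil => simp [ajlWordPhase]
  | cons g b ih =>
    rw [ajlWordPhase, List.map_cons, List.prod_cons, norm_mul, norm_crossingWeight_ajlPoint, one_mul]
    exact ih

/-- **`ajlPosBraidMatrix b = (word phase) · ajlPosCoreMatrix b`.** [cite: AharonovJonesLandau2009, Cor. 3.1] -/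
theorem ajlPosBraidMatrix_eq_smul_core (b : BraidWord n) : ajlPosBraidMatrix b = ajlWordPhase b • ajlPosCoreMatrix b := by
  induction b with
  | nil => simp [ajlPosBraidMatrix, ajlPosCoreMatrix, ajlWordPhase]
  | cons g b ih =>
    show Cryptography.placeGate (tripleEmb g.1) (ajlLocalCrossing g.2) * ajlPosBraidMatrix b =
      (crossingWeight (ajlPoint 5) g.2 false * ajlWordPhase b) •
        (Cryptography.placeGate (tripleEmb g.1) (ajlLocalCore g.2) * ajlPosCoreMatrix b)
    rw [ih, ajlLocalCrossing_eq_smul_core, placeGate_smul', Matrix.smul_mul, Matrix.mul_smul, smul_smul]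

/-- **The modulus of the `⟨enc α| · |enc α⟩` entry of the core word is `ajlRatio 5 n b`** (even
`n ≥ 2`): the scalars dropped from the crossing gates do not affect the quantity the promise problem
reads. [cite: AharonovJonesLandau2009, Thm. 3.2 and §3.3] -/
theorem norm_ajlPosCoreMatrix_apply_encodePos (hn : Even n) (h2 : 2 ≤ n) (b : BraidWord n) :
    ‖ajlPosCoreMatrix b (encodePos (ajlAlpha n)) (encodePos (ajlAlpha n))‖ = ajlRatio 5 n b := by
  rw [ajlRatio_eq_norm (by norm_num) hn h2 b, ← ajlPosBraidMatrix_apply_encodePos_ajlAlpha, ajlPosBraidMatrix_eq_smul_core,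
    Matrix.smul_apply, smul_eq_mul, norm_mul, norm_ajlWordPhase, one_mul]

/-- The core word is unitary. [cite: AharonovJonesLandau2009, Cor. 3.1] -/
theorem ajlPosCoreMatrix_mem_unitaryGroup (b : BraidWord n) :
    ajlPosCoreMatrix b ∈ Matrix.unitaryGroup (Cryptography.QReg (2 * (n + 1))) ℂ := by
  induction b with
  | nil => simp [ajlPosCoreMatrix]
  | cons g b ih =>
    rw [ajlPosCoreMatrix, List.map_cons, List.prod_cons, ← ajlPosCoreMatrix]
    exact Submonoid.mul_mem _ (Cryptography.placeGate_mem_unitaryGroup_holds _ (ajlLocalCore_mem_unitaryGroup g.2)) ih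

/-- Hence every entry of the core word has modulus `≤ 1`; in particular `ajlRatio 5 n b ≤ 1` is
visible on the core word. [folklore] -/
theorem norm_ajlPosCoreMatrix_apply_le_one (b : BraidWord n) (x y : Cryptography.QReg (2 * (n + 1))) :
    ‖ajlPosCoreMatrix b x y‖ ≤ 1 :=
  entry_norm_bound_of_unitary (ajlPosCoreMatrix_mem_unitaryGroup b) x y

end Literature.Computability.QuantumComplexity

end
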